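import Summits.KontsevichZagierPeriods.KontsevichZagierPeriods.Theorems.HurwitzMicroSectorsNormalFormPrincipleLevelOne
import Summits.KontsevichZagierPeriods.KontsevichZagierPeriods.Theorems.HurwitzMicroSectorsNormalFormPrincipleSlabASubPtK20
import Summits.KontsevichZagierPeriods.KontsevichZagierPeriods.Theorems.HurwitzMicroSectorsNormalFormPrincipleAlgCarriers
import Summits.KontsevichZagierPeriods.KontsevichZagierPeriods.Theorems.HurwitzMicroSectorsNormalFormPrincipleM2FiveZetaTwo

/-!
# `NormalFormPrinciple` (stmt-KontsevichZagierPeriods-3869), line `SketchIdeator1` — leaf `stub_boxRigidity`: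
# level one with real-algebraic coefficients: integrating out the triangle (rule 3)

Registered sub-goal `alg_triangle_sub_dimOne` of the layer "Conjecture 1 for
`[(0,1)², P(x,y)/(1 − xy)]` with `P ∈ (ℚ̄ ∩ ℝ)[x,y]`" (lead file `…AlgLevelOne`). For `b < a` and a
REAL-ALGEBRAIC coefficient `c` (`IsAlgebraic ℚ c`), the triangle representation `R = [T, g]`,
`T = {0 < z₀ < 1, 0 ≤ z₁ ≤ z₀}`, `g = c z₀^{a−b−1} z₁^b/(1 − z₁)`, and the one-dimensional
representation `N₁ = [(0,1), (c/(a−b)) s^b Σ_{i<a−b} s^i]` differ by a relation of the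
Kontsevich–Zagier calculus. The chain of moves is the one of the rational case
(`LevelOne.triangle_sub_dimOne`, seat c7), ported verbatim:

1. (rule 2) swap the two coordinates (`KZ.of_sub_of_reindex_mem_relations`): the domain becomes
   `{0 < w₁ < 1, 0 ≤ w₀ ≤ w₁}` and the integrand `h = c w₁^{a−b−1} w₀^b/(1 − w₀)`;
2. (rule 1) null adjustment: the swapped domain and the closed-fibre band
   `B₂ = {0 < w₀ < 1, w₀ ≤ w₁ ≤ 1}` over the base `(0,1)` both contain the `ℚ`-semialgebraic set
   `W = {0 < w₀ ≤ w₁ < 1}` up to the null segments `{w₀ = 0}`, `{w₁ = 1}`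
   (`KZ.IntegralRep.of_sub_of_restrict_mem_relations`, `KZ.of_sub_of_mem_relations_of_eqOn`);
3. (rule 3) ONE Newton–Leibniz move along `w₁ ∈ [w₀, 1]` with the primitive
   `F = (c/(a−b)) w₁^{a−b} w₀^b/(1 − w₀)`, `∂F/∂w₁ = h`, and
   `F(w₀, 1) − F(w₀, w₀) = (c/(a−b)) w₀^b (1 − w₀^{a−b})/(1 − w₀) = (c/(a−b)) w₀^b Σ_{i<a−b} w₀^i`.

The only change with respect to the rational case is the `ℚ`-semialgebraicity of `h` and `F` on the
band: the constant `c` is `ℚ`-semialgebraic (`isSemialgebraicFunOn_const_of_isAlgebraic`, its graph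
is cut out by the minimal polynomial of `c` and a rational isolating interval) and the remaining
factor is a quotient of `ℚ`-polynomials (`IsSemialgebraicFunOn.mul_holds`).

References: M. Kontsevich, D. Zagier, *Periods* (2001), §1.2 rules (1)–(3). No new definitions.
-/

noncomputable section

open MeasureTheory Set
open Literature.NumberTheory.Transcendental Literature.NumberTheory.Transcendental.KZ
open Literature.ModelTheory.ExponentialFields (IsSemialgebraic)

namespace Summit.KontsevichZagierPeriods.HurwitzMicroSectors.NormalFormPrinciple.PiBox.AlgLevelOne

/-! ### Semialgebraicity with an algebraic coefficient, the primitive along the last coordinate -/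

/-- On a `ℚ`-semialgebraic set `B ⊆ ℝ²` on which `1 − w₀ ≠ 0`, the function
`w ↦ c · p(w)/(1 − w₀)` with `p ∈ ℚ[w₀, w₁]` and `c` real algebraic is `ℚ`-semialgebraic: the
constant `c` is (`isSemialgebraicFunOn_const_of_isAlgebraic`) and `p/(1 − w₀)` is a quotient of
`ℚ`-polynomials. [cite: BochnakCosteRoy1998, Prop. 2.2.6] -/
theorem atsd_isSemialgebraicFunOn {B : Set (Fin 2 → ℝ)} (hB : IsSemialgebraic ℚ B)
    (hden : ∀ w ∈ B, (0:ℝ) < 1 - w 0) {c : ℝ} (hc : IsAlgebraic ℚ c)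
    (p : MvPolynomial (Fin 2) ℚ) :
    IsSemialgebraicFunOn ℚ B (fun w => c * MvPolynomial.aeval w p / (1 - w 0)) := by
  have hq : ∀ w ∈ B, MvPolynomial.aeval w (1 - MvPolynomial.X 0 : MvPolynomial (Fin 2) ℚ) ≠ 0 :=
    fun w hw => by
    simp only [map_sub, map_one, MvPolynomial.aeval_X]
    exact (hden w hw).ne'
  refine (IsSemialgebraicFunOn.mul_holds (isSemialgebraicFunOn_const_of_isAlgebraic hB hc)
    (isSemialgebraicFunOn_aeval_div_aeval hB p (1 - MvPolynomial.X 0) hq)).congr fun w _ => ?_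
  simp only [Pi.mul_apply, map_sub, map_one, MvPolynomial.aeval_X]
  exact (mul_div_assoc _ _ _).symm

/-- The derivative of the primitive `s ↦ (c/(a−b)) s^{a−b} x₀^b/(1 − x₀)` is the swapped integrand
`c s^{a−b−1} x₀^b/(1 − x₀)` (`b < a`, `c` real). [folklore] -/
theorem atsd_hasDerivAt (a b : ℕ) (c : ℝ) (hab : b < a) (x : Fin 1 → ℝ) (t : ℝ) :
    HasDerivAt (fun s : ℝ => c / ((a - b : ℕ) : ℝ) * (s ^ (a - b) * x 0 ^ b) / (1 - x 0))
      (c * (t ^ (a - b - 1) * x 0 ^ b) / (1 - x 0)) t := by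
  have hne : ((a - b : ℕ) : ℝ) ≠ 0 := Nat.cast_ne_zero.2 (Nat.sub_ne_zero_of_lt hab)
  have h := (((hasDerivAt_pow (a - b) t).mul_const (x 0 ^ b)).const_mul
    (c / ((a - b : ℕ) : ℝ))).div_const (1 - x 0)
  refine h.congr_deriv ?_
  rw [mul_assoc (((a - b : ℕ) : ℝ)), ← mul_assoc, div_mul_cancel₀ _ hne]

/-- The endpoint identity of the Newton–Leibniz move: for `x₀ ≠ 1` and `c` real,
`(c/(a−b)) x₀^b Σ_{i<a−b} x₀^i = F(x₀, 1) − F(x₀, x₀)` with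
`F(w₀, w₁) = (c/(a−b)) w₁^{a−b} w₀^b/(1 − w₀)` (finite geometric sum). [folklore] -/
theorem atsd_endpoint (a b : ℕ) (c : ℝ) {s : ℝ} (hs : s ≠ 1) :
    c / ((a - b : ℕ) : ℝ) * (s ^ b * ∑ i ∈ Finset.range (a - b), s ^ i) =
      c / ((a - b : ℕ) : ℝ) * ((1:ℝ) ^ (a - b) * s ^ b) / (1 - s) -
        c / ((a - b : ℕ) : ℝ) * (s ^ (a - b) * s ^ b) / (1 - s) := by
  have hne : (1 - s) ≠ 0 := sub_ne_zero.2 (Ne.symm hs)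
  have hS : ∑ i ∈ Finset.range (a - b), s ^ i = (1 - s ^ (a - b)) / (1 - s) := by
    rw [eq_div_iff hne]
    exact geom_sum_mul_neg s (a - b)
  rw [hS, one_pow]
  field_simp

/-! ### The stub -/

/-- **A2 (integrating out the triangle with a real-algebraic coefficient; registered sub-goal of the
algebraic level-one layer of `stub_boxRigidity` in dimension two).** For `b < a` and `c ∈ ℚ̄ ∩ ℝ`,
the triangle representation `R = [T, c z₀^{a−b−1} z₁^b/(1 − z₁)]`, `T = {0 < z₀ < 1, 0 ≤ z₁ ≤ z₀}`,
and the one-dimensional representation `N₁ = [(0,1), (c/(a−b)) s^b Σ_{i<a−b} s^i]` differ by a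
relation: swap the coordinates (rule 2), adjust the two null segments `{w₀ = 0}`, `{w₁ = 1}`
(rule 1), and make ONE Newton–Leibniz move along `w₁ ∈ [w₀, 1]` over the base `(0,1)` with the
primitive `(c/(a−b)) w₁^{a−b} w₀^b/(1 − w₀)` (rule 3), whose endpoint difference is the finite
geometric sum. [cite: KontsevichZagier2001, §1.2 rules (1)–(3)] -/
theorem alg_triangle_sub_dimOne (a b : ℕ) (c : ℝ) (hc : IsAlgebraic ℚ c) (hab : b < a)
    (R : IntegralRep 2) (N₁ : IntegralRep 1)
    (hRd : R.domain = KZlog.band {y : Fin 1 → ℝ | 0 < y 0 ∧ y 0 < 1} (fun _ => (0:ℝ)) (fun y => y 0))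
    (hRi : EqOn R.integrand (fun z => c * (z 0 ^ (a - b - 1) * z 1 ^ b) / (1 - z 1)) R.domain)
    (hN₁d : N₁.domain = {x | ∀ i, x i ∈ Set.Ioo (0:ℝ) 1})
    (hN₁i : EqOn N₁.integrand
      (fun x => c / ((a - b : ℕ) : ℝ) * (x 0 ^ b * ∑ i ∈ Finset.range (a - b), x 0 ^ i)) N₁.domain) :
    of R - of N₁ ∈ relations := by
  -- the base `τ = N₁.domain = (0,1) ⊆ ℝ¹`
  have hτ : IsSemialgebraic ℚ N₁.domain := N₁.isSemialgebraic_domain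
  have hmemτ : ∀ x : Fin 1 → ℝ, x ∈ N₁.domain ↔ 0 < x 0 ∧ x 0 < 1 := fun x => by
    rw [hN₁d]
    exact Fin.forall_fin_one
  -- membership in the triangle, the swapped triangle and the upper band
  have hmemR : ∀ z : Fin 2 → ℝ, z ∈ R.domain ↔ (0 < z 0 ∧ z 0 < 1) ∧ 0 ≤ z 1 ∧ z 1 ≤ z 0 :=
    fun z => by
    rw [hRd]
    exact Iff.rfl
  have hmemR' : ∀ w : Fin 2 → ℝ, w ∈ (R.reindex (Equiv.swap (0 : Fin 2) 1)).domain ↔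
      (0 < w 1 ∧ w 1 < 1) ∧ 0 ≤ w 0 ∧ w 0 ≤ w 1 := fun w => by
    rw [IntegralRep.reindex_domain, mem_setOf_eq, hmemR]
    simp only [Equiv.swap_apply_left, Equiv.swap_apply_right]
  have hmemB : ∀ w : Fin 2 → ℝ, w ∈ KZlog.band N₁.domain (fun y => y 0) (fun _ => (1:ℝ)) ↔
      (0 < w 0 ∧ w 0 < 1) ∧ w 0 ≤ w 1 ∧ w 1 ≤ 1 := fun w => LevelOne.tsd_mem_upperBand hN₁d
  -- the common `ℚ`-semialgebraic set `W = {0 < w₀ ≤ w₁ < 1}`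
  have hW : IsSemialgebraic ℚ {w : Fin 2 → ℝ | 0 < w 0 ∧ w 0 ≤ w 1 ∧ w 1 < 1} :=
    LevelOne.tsd_isSemialgebraic_W
  have hWm : MeasurableSet {w : Fin 2 → ℝ | 0 < w 0 ∧ w 0 ≤ w 1 ∧ w 1 < 1} :=
    Literature.ModelTheory.ExponentialFields.IsSemialgebraic.measurableSet_holds hW
  have hWR' : {w : Fin 2 → ℝ | 0 < w 0 ∧ w 0 ≤ w 1 ∧ w 1 < 1} ⊆
      (R.reindex (Equiv.swap (0 : Fin 2) 1)).domain := fun w hw =>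
    (hmemR' w).2 ⟨⟨hw.1.trans_le hw.2.1, hw.2.2⟩, hw.1.le, hw.2.1⟩
  have hWB : {w : Fin 2 → ℝ | 0 < w 0 ∧ w 0 ≤ w 1 ∧ w 1 < 1} ⊆
      KZlog.band N₁.domain (fun y => y 0) (fun _ => (1:ℝ)) := fun w hw =>
    (hmemB w).2 ⟨⟨hw.1, hw.2.1.trans_lt hw.2.2⟩, hw.2.1, hw.2.2.le⟩
  have hvolR' : volume ((R.reindex (Equiv.swap (0 : Fin 2) 1)).domain \
      {w : Fin 2 → ℝ | 0 < w 0 ∧ w 0 ≤ w 1 ∧ w 1 < 1}) = 0 := by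
    refine measure_mono_null (fun w hw => ?_)
      (Measure.pi_hyperplane (fun _ => (volume : Measure ℝ)) 0 0)
    have h := (hmemR' w).1 hw.1
    show w 0 = 0
    by_contra h0
    exact hw.2 ⟨lt_of_le_of_ne h.2.1 (Ne.symm h0), h.2.2, h.1.2⟩
  have hvolB : volume (KZlog.band N₁.domain (fun y => y 0) (fun _ => (1:ℝ)) \
      {w : Fin 2 → ℝ | 0 < w 0 ∧ w 0 ≤ w 1 ∧ w 1 < 1}) = 0 := by
    refine measure_mono_null (fun w hw => ?_)
      (Measure.pi_hyperplane (fun _ => (volume : Measure ℝ)) 1 1)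
    have h := (hmemB w).1 hw.1
    show w 1 = 1
    by_contra h1
    exact hw.2 ⟨h.1.1, h.2.1, lt_of_le_of_ne h.2.2 h1⟩
  -- the swapped integrand `h` on `W`, read off `R` through the swap
  have hRW : ∀ w ∈ {w : Fin 2 → ℝ | 0 < w 0 ∧ w 0 ≤ w 1 ∧ w 1 < 1},
      (R.reindex (Equiv.swap (0 : Fin 2) 1)).integrand w =
        c * (w 1 ^ (a - b - 1) * w 0 ^ b) / (1 - w 0) := fun w hw => by
    have hw' : (fun i => w (Equiv.swap (0 : Fin 2) 1 i)) ∈ R.domain := hWR' hw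
    rw [IntegralRep.reindex_integrand]
    show R.integrand (fun i => w (Equiv.swap (0 : Fin 2) 1 i)) = _
    rw [hRi hw']
    simp only [Equiv.swap_apply_left, Equiv.swap_apply_right]
  -- the upper-band representation `r₂ = [B₂, h]`
  have hB₂ : IsSemialgebraic ℚ (KZlog.band N₁.domain (fun y => y 0) (fun _ => (1:ℝ))) :=
    KZlog.isSemialgebraic_band (isSemialgebraicFunOn_apply hτ 0)
      (by simpa using isSemialgebraicFunOn_ratCast hτ 1)
  have hden : ∀ w ∈ KZlog.band N₁.domain (fun y => y 0) (fun _ => (1:ℝ)), (0:ℝ) < 1 - w 0 :=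
    fun w hw => sub_pos.2 ((hmemB w).1 hw).1.2
  have hh : IsSemialgebraicFunOn ℚ (KZlog.band N₁.domain (fun y => y 0) (fun _ => (1:ℝ)))
      (fun w => c * (w 1 ^ (a - b - 1) * w 0 ^ b) / (1 - w 0)) :=
    (atsd_isSemialgebraicFunOn hB₂ hden hc
      (MvPolynomial.X 1 ^ (a - b - 1) * MvPolynomial.X 0 ^ b)).congr fun w _ => by simp
  have hintW : IntegrableOn
      (fun w : Fin 2 → ℝ => c * (w 1 ^ (a - b - 1) * w 0 ^ b) / (1 - w 0))
      {w : Fin 2 → ℝ | 0 < w 0 ∧ w 0 ≤ w 1 ∧ w 1 < 1} :=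
    ((R.reindex (Equiv.swap (0 : Fin 2) 1)).integrableOn.mono_set hWR').congr_fun hRW hWm
  have hsubB : KZlog.band N₁.domain (fun y => y 0) (fun _ => (1:ℝ)) ⊆
      {w : Fin 2 → ℝ | 0 < w 0 ∧ w 0 ≤ w 1 ∧ w 1 < 1} ∪ {w | w 1 = 1} := by
    intro w hw
    have h := (hmemB w).1 hw
    rcases h.2.2.lt_or_eq with h1 | h1
    · exact Or.inl ⟨h.1.1, h.2.1, h1⟩
    · exact Or.inr h1
  have hint : IntegrableOn
      (fun w : Fin 2 → ℝ => c * (w 1 ^ (a - b - 1) * w 0 ^ b) / (1 - w 0))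
      (KZlog.band N₁.domain (fun y => y 0) (fun _ => (1:ℝ))) :=
    (hintW.union (IntegrableOn.of_measure_zero
      (Measure.pi_hyperplane (fun _ => (volume : Measure ℝ)) 1 1))).mono_set hsubB
  obtain ⟨r₂, hr₂d, hr₂i⟩ : ∃ r₂ : IntegralRep 2,
      r₂.domain = KZlog.band N₁.domain (fun y => y 0) (fun _ => (1:ℝ)) ∧
      r₂.integrand = fun w => c * (w 1 ^ (a - b - 1) * w 0 ^ b) / (1 - w 0) :=
    ⟨⟨_, _, hB₂, hh, hint⟩, rfl, rfl⟩
  have hWr₂ : {w : Fin 2 → ℝ | 0 < w 0 ∧ w 0 ≤ w 1 ∧ w 1 < 1} ⊆ r₂.domain := by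
    rw [hr₂d]
    exact hWB
  have hvolr₂ : volume (r₂.domain \ {w : Fin 2 → ℝ | 0 < w 0 ∧ w 0 ≤ w 1 ∧ w 1 < 1}) = 0 := by
    rw [hr₂d]
    exact hvolB
  -- (1) rule 2: the swap
  have hS := of_sub_of_reindex_mem_relations R (Equiv.swap (0 : Fin 2) 1)
  -- (2) rule 1: the two null adjustments and the congruence on `W`
  have hres₁ := IntegralRep.of_sub_of_restrict_mem_relations
    (R.reindex (Equiv.swap (0 : Fin 2) 1)) hW hWR' hvolR'
  have hres₂ := IntegralRep.of_sub_of_restrict_mem_relations r₂ hW hWr₂ hvolr₂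
  have hcmp : of ((R.reindex (Equiv.swap (0 : Fin 2) 1)).restrict _ hW hWR') -
      of (r₂.restrict _ hW hWr₂) ∈ relations := by
    refine of_sub_of_mem_relations_of_eqOn rfl fun w hw => ?_
    show (R.reindex (Equiv.swap (0 : Fin 2) 1)).integrand w = r₂.integrand w
    rw [hRW w hw, hr₂i]
  -- (3) rule 3: ONE Newton–Leibniz move along `w₁ ∈ [w₀, 1]` over `τ`
  have hs0 : ∀ (x : Fin 1 → ℝ) (t : ℝ), (Fin.snoc x t : Fin 2 → ℝ) 0 = x 0 := fun _ _ => rfl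
  have hs1 : ∀ (x : Fin 1 → ℝ) (t : ℝ), (Fin.snoc x t : Fin 2 → ℝ) 1 = t := fun _ _ => rfl
  have hNL : of r₂ - of N₁ ∈ relations := by
    refine newtonLeibnizRel_subset_relations ⟨1, r₂, N₁, fun y => y 0, fun _ => (1:ℝ),
      fun w => c / ((a - b : ℕ) : ℝ) * (w 1 ^ (a - b) * w 0 ^ b) / (1 - w 0),
      ?_, isSemialgebraicFunOn_apply hτ 0, (by simpa using isSemialgebraicFunOn_ratCast hτ 1),
      fun x hx => ((hmemτ x).1 hx).2.le, ?_, ?_, ?_, ?_, rfl⟩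
    · -- the primitive is `c` times a quotient of `ℚ`-polynomials on the band
      rw [hr₂d]
      refine (atsd_isSemialgebraicFunOn hB₂ hden hc
        (MvPolynomial.C (1 / ((a - b : ℕ) : ℚ)) *
          (MvPolynomial.X 1 ^ (a - b) * MvPolynomial.X 0 ^ b))).congr fun w _ => ?_
      simp only [map_mul, map_pow, MvPolynomial.aeval_C, MvPolynomial.aeval_X, eq_ratCast,
        Rat.cast_div, Rat.cast_one, Rat.cast_natCast]
      ring
    · -- the band over `τ` with edges `w₀ ≤ w₁ ≤ 1`
      rw [hr₂d]
      rfl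
    · -- continuity of the primitive on the closed fibre
      intro x _
      simp only [hs0, hs1]
      exact (by fun_prop : Continuous fun t : ℝ =>
        c / ((a - b : ℕ) : ℝ) * (t ^ (a - b) * x 0 ^ b) / (1 - x 0)).continuousOn
    · -- its derivative on the open fibre is the integrand
      intro x _ t _
      rw [hr₂i]
      simp only [hs0, hs1]
      exact atsd_hasDerivAt a b c hab x t
    · -- the endpoint difference is the finite geometric sum
      intro x hx
      rw [hN₁i hx]
      simp only [hs0, hs1]
      exact atsd_endpoint a b c ((hmemτ x).1 hx).2.ne
  -- (4) bookkeeping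
  have key : of R - of N₁ = (of R - of (R.reindex (Equiv.swap (0 : Fin 2) 1))) +
      (of (R.reindex (Equiv.swap (0 : Fin 2) 1)) -
        of ((R.reindex (Equiv.swap (0 : Fin 2) 1)).restrict _ hW hWR')) +
      (of ((R.reindex (Equiv.swap (0 : Fin 2) 1)).restrict _ hW hWR') -
        of (r₂.restrict _ hW hWr₂)) -
      (of r₂ - of (r₂.restrict _ hW hWr₂)) + (of r₂ - of N₁) := by
    abel
  rw [key]
  exact relations.add_mem (relations.sub_mem (relations.add_mem (relations.add_mem hS hres₁) hcmp)
    hres₂) hNL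

end Summit.KontsevichZagierPeriods.HurwitzMicroSectors.NormalFormPrinciple.PiBox.AlgLevelOne
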